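import Literature.AlgebraicGeometry.HodgeTheory.HodgeConjectureQbarVoisin
import Literature.AlgebraicGeometry.HodgeTheory.HodgeConjectureQbarVoisinProofs
import Literature.AlgebraicGeometry.HodgeTheory.AbsoluteHodgeClassFlatSpread
import Literature.AlgebraicGeometry.HodgeTheory.AlgebraicClassesFibreRestriction
import Literature.AlgebraicGeometry.HodgeTheory.HodgeGenericQbarDescentFiniteMonodromyInputs
import Literature.AlgebraicGeometry.HodgeTheory.IsoTransport
import Literature.AlgebraicGeometry.HodgeTheory.ComplexConjugationHolds
import Literature.AlgebraicGeometry.HodgeTheory.HodgeFiltrationModelsReductionProofs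
import HarnessLib

/-!
# Voisin (2007), Prop. 1.2 with the `ℚ̄`-hypothesis "HC for all `X₀ ×_σ ℂ`", PROVED from the spread of the class and the partie fixe

Topic `Literature/AlgebraicGeometry/HodgeTheory` (family `hodge`). Theorems only (no named fact).
Companion of `HodgeConjectureQbarVoisin.lean` (the named fact
`voisin2007_hodgeConjecture_weaklyAbsolute_of_qbar` = Prop. 1.2, weakly absolute reading, and its
corollary `hodgeConjecture_weaklyAbsolute_of_hodgeConjectureFor_qbar`: HC for every `X₀ ×_{ℚ̄,σ} ℂ`
⟹ every weakly absolute Hodge class on every smooth projective complex variety is algebraic) and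
of `HodgeConjectureQbarVoisinProofs.lean` (the proved bricks of the printed proof).

Source, read: C. Voisin, *Hodge loci and absolute Hodge classes*, Compositio Math. 143 (2007)
945–958 = arXiv:math/0605766, §3, proof of Prop. 1.2 (p. 6). For a weakly absolute class `α` on `X`:

* (S1) *"By the geometric interpretation given above, and by Lemma 2.4 in the weakly absolute case,
  it follows that there exist smooth irreducible quasi-projective varieties `𝒳, T` defined over
  `ℚ̄`, a projective morphism `π : 𝒳 → T`, and a locally constant global section
  `α̃ ∈ H⁰(T, R^{2k}π_*ℚ)`, such that `X` is one fiber of `π` and `α` is the restriction of `α̃` to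
  this fiber"* — the named fact `voisin2007_flatSpread_of_isWeaklyAbsoluteHodgeClass`
  (`AbsoluteHodgeClassFlatSpread.lean`, hypothesis `hWS`): a continuous global section `τ` of the
  espace étalé `FiberClass (f₀ ⊗ σ) (2p)` of `R²ᵖ f_* ℂ` through `(t, (e⁻¹)^* c)`, `e : X ≅ 𝒳_t`.
* (S2) *"Deligne's global invariant cycle theorem says now that for any smooth completion `𝒳̄` of
  `𝒳`, there exists a Hodge class `β ∈ Hdg²ᵏ(𝒳̄)` such that `β|_X = α`. Of course, we may also
  choose `𝒳̄` defined over `ℚ̄`"* — Hironaka over `ℚ̄` is the tree's theorem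
  `exists_isSmoothProjective_isOpenImmersion` (`𝒳₀` is smooth by descent from `ℂ`, quasi-projective,
  irreducible); the partie fixe is the named fact `deligne_globalInvariantCycles` (hypothesis `hD`);
  the Hodge refinement *"β Hodge"* (the polarisation argument, p. 6) is the proved
  `deligne_globalInvariantCycles.exists_hodgeClass_eq_globalSection_of_exists_isReal_hodgeModel` fed
  with the theorems `exists_isReal_hodgeModel_holds`, `hodgePQ_independent_of_hodgeModel_holds`,
  `smoothProjective_hodgeStructure_isPolarizable_holds`.
* (S3) *"`β` is the class of an algebraic cycle, and then, so is its restriction `α`"* — with the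
  hypothesis "HC for ALL Hodge classes on all `X₀ ×_σ ℂ`" (`hQ`, the form consumed by the
  `ℚ̄`-anchored routes and by the strong hypothesis `QbarSummit`), `β`, rational of type `(p,p)` on
  `𝒳̄₀ ⊗_σ ℂ`, is algebraic WITHOUT the printed claim "`β` may be chosen weakly absolute" (needed in
  print only because the printed hypothesis is HC for weakly absolute classes over `ℚ̄`; that claim
  needs the functoriality of `σ`-conjugation of classes, not in the tree); restriction along
  `𝒳_t ⟶ 𝒳 ⟶ 𝒳̄` is `map_fiberι_comp_mem_algebraicClasses_of_isSmoothProjective` and transport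
  along `e` is `mem_algebraicClasses_map_iff_of_iso` (both proved).

## Main results

* `mem_algebraicClasses_of_isWeaklyAbsoluteHodgeClass_of_flatSpread` —
  `voisin2007_flatSpread_of_isWeaklyAbsoluteHodgeClass` → `deligne_globalInvariantCycles` → HC for all
  `X₀ ×_σ ℂ` → every weakly absolute Hodge class on every smooth projective complex variety is
  algebraic (the whole printed proof after its first sentence, PROVED on the tree's carriers).
* `hodgeConjecture_weaklyAbsolute_of_hodgeConjectureFor_qbar_of_flatSpread`,
  `hodgeConjecture_absolute_of_hodgeConjectureFor_qbar_of_flatSpread` — the conclusions of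
  `hodgeConjecture_weaklyAbsolute_of_hodgeConjectureFor_qbar` / `…_absolute_…`
  (`HodgeConjectureQbarVoisin.lean`) with their hypothesis `hV : voisin2007_hodgeConjecture_…_of_qbar`
  REPLACED by S1 and the partie fixe.
* `hodgeConjectureFor_of_hodgeConjectureFor_qbar_of_forall_isWeaklyAbsolute_of_flatSpread` — HC for
  all `X₀ ×_σ ℂ` ∧ "every rational `(p,p)` class is weakly absolute" ⟹ `HodgeConjectureFor n X` for
  every smooth projective complex `X`: the Literature-side content of the strong-hypothesis bridge
  `QbarSummit ⟹ HodgeConjecture` (`Summits/HodgeConjecture/StrongHypotheses.lean`), whose summit-side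
  proof is then `fun h _ _ hX ↦ (this theorem) hWS hD h.1 h.2 hX`.

CONDITIONAL on the two named facts; sorry-free; no new named fact (D-0026).

## References

* C. Voisin, *Hodge loci and absolute Hodge classes*, Compositio Math. 143 (2007) 945–958, Prop. 1.2,
  Rem. 1.4, Def. 2.1, Lemma 2.4, §3 proof of Prop. 1.2 (arXiv math/0605766 pp. 2, 4–6). [Voisin2007HodgeLoci]
* P. Deligne, *Théorie de Hodge II*, Publ. Math. IHÉS 40 (1971), Thm. 4.1.1. [DeligneHodgeII1971]
* H. Hironaka, *Resolution of singularities …*, Ann. of Math. 79 (1964), Main Theorem I. [Hironaka1964]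
* F. Charles, C. Schnell, *Notes on absolute Hodge classes* (Math. Notes 49, 2014), Thm. 11.3.4,
  Prop. 11.3.5, Thm. 11.3.17. [CharlesSchnell2014Notes]
-/

noncomputable section

open CategoryTheory CategoryTheory.Limits AlgebraicGeometry
open _root_.Topology
open Literature.AlgebraicTopology.SingularHomology

namespace Literature.AlgebraicGeometry.HodgeTheory

section HodgeTheory

open Literature.AlgebraicGeometry.Motives

/-- **Voisin 2007, Prop. 1.2 (weakly absolute reading, `ℚ̄`-hypothesis "HC for all `X₀ ×_σ ℂ`"),
from the spread of the class (S1) and Deligne's partie fixe.** Granted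
`voisin2007_flatSpread_of_isWeaklyAbsoluteHodgeClass` (`hWS`: the first sentence of the printed
proof for weakly absolute classes, *"there exist smooth irreducible quasi-projective varieties
`𝒳, T` defined over `ℚ̄`, a projective morphism `π : 𝒳 → T`, and a locally constant global section
`α̃ ∈ H⁰(T, R^{2k}π_*ℚ)`, such that `X` is one fiber of `π` and `α` is the restriction of `α̃` to
this fiber"*) and `deligne_globalInvariantCycles` (`hD`): if the Hodge conjecture holds for every
smooth projective `X₀ ×_{ℚ̄,σ} ℂ` (`hQ`), then every weakly absolute Hodge class `c` on every smooth
projective complex `X` lies in `algebraicClasses X p`. Proof = §3, p. 6: spread (`hWS`);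
`(e⁻¹)^* c` is rational of type `(p,p)` (iso transport), so `τ t` lies in the locus of Hodge
classes; compactify `𝒳₀` over `ℚ̄` (Hironaka, `exists_isSmoothProjective_isOpenImmersion`); Hodge
lift `β` on `𝒳̄₀ ⊗_σ ℂ` (`hD` + the proved polarisation argument); `β` algebraic by `hQ σ`;
restrict to `𝒳_t` and transport along `e`. CONDITIONAL on `hWS`, `hD`.
[cite: Voisin2007HodgeLoci, Prop. 1.2, Rem. 1.4, Def. 2.1 and §3 (proof of Prop. 1.2)]
[cite: DeligneHodgeII1971, Théorème 4.1.1] [cite: Hironaka1964, Main Theorem I] -/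
theorem mem_algebraicClasses_of_isWeaklyAbsoluteHodgeClass_of_flatSpread
    (hWS : voisin2007_flatSpread_of_isWeaklyAbsoluteHodgeClass) (hD : deligne_globalInvariantCycles)
    (hQ : ∀ (σ : AlgebraicClosure ℚ →+* ℂ) ⦃n : ℕ⦄ ⦃X₀ : SchemeOver (AlgebraicClosure ℚ)⦄,
      IsSmoothProjective n ((baseChangeHom σ).obj X₀) → HodgeConjectureFor n ((baseChangeHom σ).obj X₀))
    {n : ℕ} {X : SchemeOver ℂ} (hX : IsSmoothProjective n X) {p : ℕ} {c : complexBetti X (2 * p)}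
    (hc : IsWeaklyAbsoluteHodgeClass n X p c) : c ∈ algebraicClasses X p := by
  obtain ⟨σ, 𝒳₀, T₀, f₀, t, e, h𝒳₀, hT₀, hirr, hsm, hf, τ, hτc, hτpt, hτt⟩ := hWS hX p c hc
  -- `(e⁻¹)^* c` is rational of type `(p,p)` on `𝒳_t` (iso transport), i.e. `τ t` is in the locus
  have h₀ : τ t ∈ locusOfHodgeClasses ((baseChangeHom σ).map f₀) n p := by
    rw [hτt, mem_locusOfHodgeClasses_iff]
    exact ⟨(isRationalClass_map_iff_of_iso e.symm).2 hc.1, (isOfHodgeType_map_iff_of_iso e.symm).2 hc.2.1⟩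
  -- the base `T = T₀ ⊗ ℂ`: smooth of pure dimension `d`, quasi-projective, irreducible
  haveI := hsm
  haveI := hirr
  haveI : IrreducibleSpace T₀.left := irreducibleSpace_of_irreducibleSpace_baseChangeHom_obj σ T₀
  obtain ⟨d, hd⟩ := Motives.exists_smoothOfRelativeDimension_of_smooth T₀.hom
  haveI := hd
  haveI hTd : SmoothOfRelativeDimension d ((baseChangeHom σ).obj T₀).hom :=
    smoothOfRelativeDimension_baseChangeHom_hom σ d T₀
  have hTqp : IsQuasiProjectiveOver ((baseChangeHom σ).obj T₀) := hT₀.baseChangeHom σ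
  haveI : LocallyOfFiniteType ((baseChangeHom σ).obj T₀).hom := hTqp.locallyOfFiniteType
  haveI hTs : AlgebraicGeometry.Smooth ((baseChangeHom σ).obj T₀).hom :=
    SmoothOfRelativeDimension.smooth d _
  -- S2a: a smooth projective compactification of `𝒳₀` DEFINED OVER `ℚ̄` (Hironaka over `ℚ̄`):
  -- `𝒳₀` is smooth (descent from `ℂ`), quasi-projective and irreducible (`𝒳₀ ⊗ ℂ` is)
  haveI : AlgebraicGeometry.Smooth ((baseChangeHom σ).map f₀).left := hf.smooth
  haveI : AlgebraicGeometry.Smooth f₀.left := smooth_of_smooth_baseChangeHom_map_left σ f₀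
  haveI : AlgebraicGeometry.Smooth 𝒳₀.hom := by
    rw [← Over.w f₀]
    infer_instance
  haveI : IrreducibleSpace ((baseChangeHom σ).obj 𝒳₀).left :=
    irreducibleSpace_of_isSmoothProjectiveFamily _ hf
  haveI : IrreducibleSpace 𝒳₀.left := irreducibleSpace_of_irreducibleSpace_baseChangeHom_obj σ 𝒳₀
  obtain ⟨m, hm⟩ := exists_smoothOfRelativeDimension_of_smooth 𝒳₀.hom
  obtain ⟨Xbar₀, i₀, hXbar₀, hi₀⟩ :=
    exists_isSmoothProjective_isOpenImmersion m 𝒳₀ hm h𝒳₀ inferInstance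
  haveI := hi₀
  have hXbar : IsSmoothProjective m ((baseChangeHom σ).obj Xbar₀) :=
    IsSmoothProjective.baseChangeHom_holds σ hXbar₀
  set i : (baseChangeHom σ).obj 𝒳₀ ⟶ (baseChangeHom σ).obj Xbar₀ := (baseChangeHom σ).map i₀ with hi_def
  haveI hi : IsOpenImmersion i.left := isOpenImmersion_baseChangeHom_map_left σ i₀
  -- S2b: the partie fixe `hD` + the proved Hodge lift: a rational `(p,p)` class `β` on `𝒳̄₀ ⊗ ℂ`
  obtain ⟨β, hβr, hβh, hβσ⟩ :=
    hD.exists_hodgeClass_eq_globalSection_of_exists_isReal_hodgeModel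
      exists_isReal_hodgeModel_holds hodgePQ_independent_of_hodgeModel_holds
      smoothProjective_hodgeStructure_isPolarizable_holds _ i hf hTqp hTs hXbar hi hτc hτpt h₀
  have hα'eq : complexBetti.map e.inv (2 * p) c =
      complexBetti.map (fiberι ((baseChangeHom σ).map f₀) t ≫ i) (2 * p) β := by
    have h1 := hτt.symm.trans hβσ
    rw [globalSection] at h1
    simp only [FiberClass.mk.injEq, heq_eq_eq, true_and] at h1
    rw [h1, complexBetti.map_comp, ModuleCat.comp_apply]
  -- S3: HC on `𝒳̄₀ ⊗_σ ℂ` (hypothesis `hQ`) ⇒ `β` algebraic; restrict to `𝒳_t`, transport along `e`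
  have hβalg : β ∈ algebraicClasses ((baseChangeHom σ).obj Xbar₀) p := (hQ σ hXbar).2 p β hβr hβh
  have hα'alg : complexBetti.map e.inv (2 * p) c ∈
      algebraicClasses (fiberOver ((baseChangeHom σ).map f₀) t) p := by
    rw [hα'eq]
    exact map_fiberι_comp_mem_algebraicClasses_of_isSmoothProjective _ hf hTqp hXbar i hβalg t
  exact (mem_algebraicClasses_map_iff_of_iso e.symm).1 hα'alg

/-- **The routes' corollary, `hV` replaced by S1 and the partie fixe.** In the binder shape of
`hodgeConjecture_weaklyAbsolute_of_hodgeConjectureFor_qbar` (`HodgeConjectureQbarVoisin.lean`):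
granted `voisin2007_flatSpread_of_isWeaklyAbsoluteHodgeClass` and `deligne_globalInvariantCycles`,
if the Hodge conjecture holds for every smooth projective complex variety of the form
`X₀ ×_{ℚ̄,σ} ℂ`, then every weakly absolute Hodge class on every smooth projective complex variety
is algebraic — Voisin's Prop. 1.2 with its hypothesis strengthened from "weakly absolute classes
over `ℚ̄`" to "all Hodge classes over `ℚ̄`", a theorem modulo the two named inputs instead of the
named fact `voisin2007_hodgeConjecture_weaklyAbsolute_of_qbar`; with `QbarSummit` (2) (every
rational `(p,p)` class is weakly absolute) it closes the summit exactly as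
`SC.hodgeConjecture_of_qbarSummit` does. [cite: Voisin2007HodgeLoci, Prop. 1.2 and §3 (proof of Prop. 1.2)]
[cite: DeligneHodgeII1971, Théorème 4.1.1] -/
theorem hodgeConjecture_weaklyAbsolute_of_hodgeConjectureFor_qbar_of_flatSpread
    (hWS : voisin2007_flatSpread_of_isWeaklyAbsoluteHodgeClass) (hD : deligne_globalInvariantCycles)
    (hQ : ∀ (σ : AlgebraicClosure ℚ →+* ℂ) ⦃n : ℕ⦄ ⦃X₀ : Motives.SchemeOver (AlgebraicClosure ℚ)⦄,
      Motives.IsSmoothProjective n ((Motives.baseChangeHom σ).obj X₀) →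
        HodgeConjectureFor n ((Motives.baseChangeHom σ).obj X₀))
    {n : ℕ} {X : Motives.SchemeOver ℂ} (hX : Motives.IsSmoothProjective n X) {p : ℕ}
    {c : complexBetti X (2 * p)} (hc : IsWeaklyAbsoluteHodgeClass n X p c) :
    c ∈ algebraicClasses X p :=
  mem_algebraicClasses_of_isWeaklyAbsoluteHodgeClass_of_flatSpread hWS hD hQ hX hc

/-- The same for ABSOLUTE Hodge classes (they are weakly absolute,
`IsAbsoluteHodgeClass.isWeaklyAbsoluteHodgeClass`): granted the weakly absolute spread and the
partie fixe, HC for every `X₀ ×_{ℚ̄,σ} ℂ` gives the algebraicity of every absolute Hodge class on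
every smooth projective complex variety (the conclusion of
`hodgeConjecture_absolute_of_hodgeConjectureFor_qbar` without the named fact
`voisin2007_hodgeConjecture_absolute_of_qbar`). [cite: Voisin2007HodgeLoci, Prop. 1.2 and Def. 1.1] -/
theorem hodgeConjecture_absolute_of_hodgeConjectureFor_qbar_of_flatSpread
    (hWS : voisin2007_flatSpread_of_isWeaklyAbsoluteHodgeClass) (hD : deligne_globalInvariantCycles)
    (hQ : ∀ (σ : AlgebraicClosure ℚ →+* ℂ) ⦃n : ℕ⦄ ⦃X₀ : Motives.SchemeOver (AlgebraicClosure ℚ)⦄,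
      Motives.IsSmoothProjective n ((Motives.baseChangeHom σ).obj X₀) →
        HodgeConjectureFor n ((Motives.baseChangeHom σ).obj X₀))
    {n : ℕ} {X : Motives.SchemeOver ℂ} (hX : Motives.IsSmoothProjective n X) {p : ℕ}
    {c : complexBetti X (2 * p)} (hc : IsAbsoluteHodgeClass n X p c) :
    c ∈ algebraicClasses X p :=
  mem_algebraicClasses_of_isWeaklyAbsoluteHodgeClass_of_flatSpread hWS hD hQ hX
    hc.isWeaklyAbsoluteHodgeClass

/-- **HC for base changes from `ℚ̄` ∧ "every Hodge class is weakly absolute" ⟹ HC for every smooth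
projective complex variety, cycle part** — the Literature-side content of the strong-hypothesis
bridge `QbarSummit ⟹ HodgeConjecture` (`Summits/HodgeConjecture/StrongHypotheses.lean`), modulo
`voisin2007_flatSpread_of_isWeaklyAbsoluteHodgeClass` and `deligne_globalInvariantCycles`: for `X`
smooth projective over `ℂ`, if every rational `(p,p)` class on every smooth projective complex
variety is weakly absolute (`hW`, Voisin's Thm. 0.5-type hypothesis) and HC holds for all
`X₀ ×_σ ℂ` (`hQ`), then `HodgeConjectureFor n X` (the Hodge model conjunct by
`nonempty_hodgeModel_holds`). [cite: Voisin2007HodgeLoci, Prop. 1.2, Rem. 1.4 and Def. 2.1] -/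
theorem hodgeConjectureFor_of_hodgeConjectureFor_qbar_of_forall_isWeaklyAbsolute_of_flatSpread
    (hWS : voisin2007_flatSpread_of_isWeaklyAbsoluteHodgeClass) (hD : deligne_globalInvariantCycles)
    (hQ : ∀ (σ : AlgebraicClosure ℚ →+* ℂ) ⦃n : ℕ⦄ ⦃X₀ : Motives.SchemeOver (AlgebraicClosure ℚ)⦄,
      Motives.IsSmoothProjective n ((Motives.baseChangeHom σ).obj X₀) →
        HodgeConjectureFor n ((Motives.baseChangeHom σ).obj X₀))
    (hW : ∀ ⦃n : ℕ⦄ ⦃X : Motives.SchemeOver ℂ⦄, Motives.IsSmoothProjective n X →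
      ∀ (p : ℕ) (c : complexBetti X (2 * p)), IsRationalClass c → IsOfHodgeType n X (2 * p) p p c →
        IsWeaklyAbsoluteHodgeClass n X p c)
    {n : ℕ} {X : Motives.SchemeOver ℂ} (hX : Motives.IsSmoothProjective n X) :
    HodgeConjectureFor n X :=
  ⟨nonempty_hodgeModel_holds hX, fun p c hc hpp ↦
    mem_algebraicClasses_of_isWeaklyAbsoluteHodgeClass_of_flatSpread hWS hD hQ hX (hW hX p c hc hpp)⟩

end HodgeTheory

end Literature.AlgebraicGeometry.HodgeTheory

end
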